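import Literature.AnabelianGeometry.EtaleTheta.Discharge.Sec2DtpYThetaAbelianCorollaries
import Literature.AnabelianGeometry.EtaleTheta.Discharge.Sec2Prop214iiOfOrigin
import Literature.AnabelianGeometry.EtaleTheta.Discharge.Sec2Cor218QuotientFibreIff
import Literature.AnabelianGeometry.EtaleTheta.Discharge.Sec2Cor218LevelsOfModel
import Literature.AnabelianGeometry.EtaleTheta.Discharge.Sec2Prop214iiiCuspLabels
import Literature.AnabelianGeometry.EtaleTheta.Discharge.Sec2ModelCor219
import Literature.AnabelianGeometry.EtaleTheta.SettingModelTateInstance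
import Literature.AnabelianGeometry.EtaleTheta.SettingModelTateDoubleUnderline
import Literature.AnabelianGeometry.EtaleTheta.SettingModelTateGroupLevel
import HarnessLib

/-!
# [EtTh] §2 (Prop 2.12, Prop 2.14, Cor 2.18 (ii)–(iv), Cor 2.19 (i)(ii)) for the §1 → §2 rigidity data
# AT THE STAGE-2 RECORD MODEL `ThetaSetting.modelχq p i j hj` (Tate instance `modelTate p = modelχq p 1 2`):
# the guard `IsEtThOrigin`, the binder `hYcl`, `Sec2Hyps`/`Compat`, temp-slimness of `Π^tp_X` and openness of
# `Π^tp_X ↠ G_K` are THEOREMS there (proof-only capstone; FROZEN FACT-LIST rows F-0631 `Prop214_i`, F-0633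
# `Prop214_iii_bi`, F-0634 `Prop214_iii_mono`, with F-1920/F-0630/F-0624/F-0622/F-0623/F-0632/F-0621 riding)

Mochizuki, *The Étale Theta Function and its Frobenioid-theoretic Manifestations* [EtTh], Publ. RIMS **45**
(2009), §2: Prop. 2.12 (i)(ii) PRIMS PDF p. 45, Prop. 2.14 (i)(ii) p. 49, (iii) pp. 49–50, Cor. 2.18 (ii) p. 60,
(iii)/(iv) p. 61, Cor. 2.19 (i)(ii) p. 64 [cite: MochizukiEtTh2009, Prop 2.14 (i) p.49].  Cell `abc-iut`, block F,
seat abc-iut-f-149 (gen 3; F-TRANCHES tranche 149 = F-0631/F-0632/F-0633/F-0634 of D-0078 (S1), trunk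
`ThetaRigidity.lean`).  PROOF-ONLY: no definition, no instance, no new named fact; nothing of another seat is edited
or restated — every input is consumed BY NAME.

STATE OF RECORD.  Over the lawless interface `RigidData N l` the universal closures of these rows are REFUTED at
explicit toys (abc-iut-w5-d175 `RigidData.Toy.not_forall_prop214_i / _iii_mono / _iii_bi`, …), so the rows are
consumable AT A NAMED INSTANCE only (R5).  The named instance the cone consumes is abc-iut-L2-t8's §1 → §2 adapter
`C.rigidData μ hC hS h15 L` / `C.thetaEnvData μ hC hS` / `C.thetaEnvTower τ hC hS` (`RigidOfSetting.lean`) over a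
theta setting `D`; lane C2 PROVED the rows there modulo the guard `hO : D.IsEtThOrigin`, the binder `hYcl`,
temp-slimness `hslimX : IsSlimGroup D.PiTemp`, `haugOpen : IsOpenMap D.aug`, and (for 2.14 (ii) / 2.18 (ii))
the §1 fact `Prop15ii` (F-2503).  Gen 2 of this seat (`Sec2RigidityAtModelChi`, p436524) and abc-iut-f-150
(`Sec2Cor218Cor219AtModelChi`) discharged those binders at the STAGE-1 record `ThetaSetting.modelχ p`.

WHY THIS FILE (honesty datum).  Every `RigidData`-currency instance form carries the binder
`h15 : Prop15iii E hC` (an INPUT of `rigidData`), and at the stage-1 model that binder is REFUTED along the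
whole section family — abc-iut-L2-t12's `SettingModel.not_prop15iii_etaleThetaDataχSec` («expected-false at
stage 1 by design»: the pure deck generator fixes `log(Ü)`, whereas the typed `Z`-action clause needs the Tate
shear).  So the stage-1 tokens are consistency evidence for `{IsEtThOrigin, hYcl}` but VACUOUS in `h15` for
the data of record.  The R78 cluster's STAGE-2 («Tate shear») record `ThetaSetting.modelχq p i j hj`
(abc-iut-L2-t5 `SettingModelTateTheta`; Tate instance `ThetaSetting.modelTate p := modelχq p 1 2`,
`SettingModelTateInstance`) is where Prop. 1.5 (iii) is to be witnessed, and there ALL FIVE model-side binders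
are already THEOREMS: `ThetaSetting.modelχq_isEtThOrigin`, `SettingModel.hYcl_modelχq` (L2-t5),
`ThetaSetting.modelχq_sec2Hyps` (L2-d1, `SettingModelTateDoubleUnderline`; whence `Compat`),
`SettingModel.isSlimGroup_PiTpχq` (L2-t5/w5-d249, `SettingModelTateGroupLevel`) and
`SettingModel.isOpenMap_aug_modelχq`.  Hence, for EVERY `(i, j)` with `j` even, every étale-theta datum `E`
over `modelχq p i j hj`, every `X̲̲`-choice `C : E.DoubleUnderline l`, every level `μ` / tower `τ`, `hC`, `hS`:

* §1 — F-0631 `Prop214_i`, F-1920 `Prop212_i`, F-0630 `Prop212_ii`, F-0624 `Cor218_iv_fibre` HOLD for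
  `C.rigidData μ hC hS h15 L` (binders left: the construction data `E, C, μ, hC, hS, h15, L`);
* §2 — F-0622/F-0623 (`RigidData.Cor218_iii_PiX/_quotient`) and their `ThetaEnvData` twins F-0636/F-0637 HOLD
  with NO slimness binder; the `ThetaEnvData` forms carry NO `h15` at all (binders `E, C, μ, hC, hS` only);
* §3 — F-0634 `Prop214_iii_mono`, F-0633 `Prop214_iii_bi` HOLD at every labelling with EMPTY `Y`-cusp labels
  (abc-iut-f-149 g0's characterisation + §2), and FAIL at the degenerate labelling `1 ↦ {⊥}` for every datum
  (g0's `not_forall_cuspLabels_rigidData_prop214_iii_*`, instantiated): the rows are schemata in the lawless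
  label input `cuspY` — recorded, not adjudicated;
* §4 — F-0632 `Prop214_ii`, F-0621 `Cor218_ii` modulo `Prop15ii` ONLY;
* §5 — Cor. 2.19 (i) (F-0625/F-0626) modulo Cor. 2.18 (i) alone; Cor. 2.18 (iv) reduction (F-0648) for the
  tower with NO binder beyond `E, C, τ, hC, hS`; Cor. 2.19 (ii) (F-0649) modulo the level-wise lifting fact;
* §6 — joint census forms with `hC`, `hS` SUPPLIED (`compat_modelχq`, `modelχq_sec2Hyps`), and §7 the same
  BY NAME at the Tate instance `modelTate p`.

HONEST LABEL: `modelχq` is a SEMI-SYNTHETIC model of the typed §1 interface (not the tempered `π₁` of a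
curve) — this file is consistency / joint-satisfiability evidence for the binder set
{`IsSlimGroup Π^tp_X`, `IsOpenMap aug`, `IsEtThOrigin`, `hYcl`, `Sec2Hyps`, `Compat`} of the lane-C2
discharges at the stage where `Prop15iii` is NOT refuted by design, and the kernel record that the FACT rows
above are THEOREMS at that inhabitant modulo the construction data; whether `h15` is inhabited at stage 2 is
the R78 cluster's open hand (nothing here claims it).  Nothing of [EtTh] / [SemiAnbd] (refereed) is
asserted; no side is taken on [IUTchIII] Cor. 3.12; typed ≠ proved; a FACT row is an assumption label, not
an endorsement.
-/

noncomputable section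

namespace Literature.AnabelianGeometry.EtaleTheta.SettingModel

open Literature.AnabelianGeometry.SemiGraphs
open Literature.AlgebraicGeometry.Frobenioids (IsSlimGroup)

variable (p : ℕ) [Fact p.Prime] (i j : ℤ) (hj : Even j)
variable {E : (ThetaSetting.modelχq p i j hj).EtaleThetaData} {l : ℕ} (C : E.DoubleUnderline l) {N : ℕ+}
  (μ : (ThetaSetting.modelχq p i j hj).CyclotomeMod l N) {Es : Set ℕ+}
  (τ : (ThetaSetting.modelχq p i j hj).CyclotomeTower l Es)

/-! ## §0. The model-side binders at the stage-2 record -/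

/-- **`Π^tp_X` of the stage-2 record `modelχq p i j hj` is temp-slim** — the binder
`hslimX : IsSlimGroup D.PiTemp` of the lane-C2 discharges, BY NAME abc-iut-L2-t5's `isSlimGroup_PiTpχq`
(`Γ` slim, `G_{ℚ_p}` slim, any action). [cite: MochizukiSemiAnbd2006, Ex 3.10 p.45] -/
theorem isSlimGroup_piTemp_modelχq : IsSlimGroup (ThetaSetting.modelχq p i j hj).PiTemp :=
  isSlimGroup_PiTpχq p i j

/-- **`Compat` holds at the stage-2 record** (from abc-iut-L2-d1's `modelχq_sec2Hyps` by `Sec2Hyps.compat`).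
[cite: MochizukiEtTh2009, Prop 1.5 p.22] -/
theorem compat_modelχq : (ThetaSetting.modelχq p i j hj).Compat :=
  (ThetaSetting.modelχq_sec2Hyps p i j hj).compat

/-! ## §1. Prop 2.14 (i), Prop 2.12 (i)(ii), Cor 2.18 (iv) fibres — guard and `hYcl` discharged -/

/-- **F-0631 `RigidData.Prop214_i` at the stage-2 record's rigidity data** ([EtTh] Prop. 2.14 (i), p. 49:
"the subset `{γ(β)·β⁻¹}` … coincides with the image of the tautological section of `(l·Δ_Θ)[μ_N] ↠ (l·Δ_Θ)`"):
for every étale-theta datum over `modelχq p i j hj`, every `X̲̲`, level and labelling — abc-iut-L2-t8's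
`rigidData_prop214_i_of_origin` with `IsEtThOrigin`, `hYcl` supplied by `modelχq_isEtThOrigin`, `hYcl_modelχq`.
[cite: MochizukiEtTh2009, Prop 2.14 (i) p.49] -/
theorem rigidData_prop214_i_modelχq (hC : (ThetaSetting.modelχq p i j hj).Compat)
    (hS : (ThetaSetting.modelχq p i j hj).Sec2Hyps) (h15 : ThetaSetting.Prop15iii E hC) (L : C.CuspLabels) :
    Literature.AnabelianGeometry.EtaleTheta.RigidData.Prop214_i (C.rigidData μ hC hS h15 L) :=
  C.rigidData_prop214_i_of_origin μ hC hS h15 L (ThetaSetting.modelχq_isEtThOrigin p i j hj)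
    (hYcl_modelχq p i j hj)

/-- **F-1920 `RigidData.Prop212_i` at the stage-2 record's rigidity data** ([EtTh] Prop. 2.12 (i), p. 45:
"`l·Δ_Θ ⊆ [Δ^Θ_*, Δ^Θ_*]`"). [cite: MochizukiEtTh2009, Prop 2.12 (i) p.45] -/
theorem rigidData_prop212_i_modelχq (hC : (ThetaSetting.modelχq p i j hj).Compat)
    (hS : (ThetaSetting.modelχq p i j hj).Sec2Hyps) (h15 : ThetaSetting.Prop15iii E hC) (L : C.CuspLabels) :
    Literature.AnabelianGeometry.EtaleTheta.RigidData.Prop212_i (C.rigidData μ hC hS h15 L) :=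
  C.rigidData_prop212_i_of_origin μ hC hS h15 L (ThetaSetting.modelχq_isEtThOrigin p i j hj)
    (hYcl_modelχq p i j hj)

/-- **F-0630 `RigidData.Prop212_ii` at the stage-2 record's rigidity data** ([EtTh] Prop. 2.12 (ii), p. 45:
"follows formally from (i)"). [cite: MochizukiEtTh2009, Prop 2.12 (ii) p.45] -/
theorem rigidData_prop212_ii_modelχq (hC : (ThetaSetting.modelχq p i j hj).Compat)
    (hS : (ThetaSetting.modelχq p i j hj).Sec2Hyps) (h15 : ThetaSetting.Prop15iii E hC) (L : C.CuspLabels) :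
    Literature.AnabelianGeometry.EtaleTheta.RigidData.Prop212_ii (C.rigidData μ hC hS h15 L) :=
  C.rigidData_prop212_ii_of_origin μ hC hS h15 L (ThetaSetting.modelχq_isEtThOrigin p i j hj)
    (hYcl_modelχq p i j hj)

/-- **F-0624 `RigidData.Cor218_iv_fibre` at the stage-2 record's rigidity data** ([EtTh] Cor. 2.18 (iv),
p. 61: the fibres of "liftings ↦ induced automorphism" are the printed twists, via Prop. 2.14 (i)).
[cite: MochizukiEtTh2009, Cor 2.18 (iv) p.61] -/
theorem rigidData_cor218_iv_fibre_modelχq (hC : (ThetaSetting.modelχq p i j hj).Compat)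
    (hS : (ThetaSetting.modelχq p i j hj).Sec2Hyps) (h15 : ThetaSetting.Prop15iii E hC) (L : C.CuspLabels) :
    Literature.AnabelianGeometry.EtaleTheta.RigidData.Cor218_iv_fibre (C.rigidData μ hC hS h15 L) :=
  C.rigidData_cor218_iv_fibre_of_origin μ hC hS h15 L (ThetaSetting.modelχq_isEtThOrigin p i j hj)
    (hYcl_modelχq p i j hj)

/-! ## §2. Cor 2.18 (iii) — no slimness binder -/

/-- **F-0622 / F-0623 (`RigidData.Cor218_iii_PiX`, `.Cor218_iii_quotient`) at the stage-2 record's rigidity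
data** ([EtTh] Cor. 2.18 (iii), p. 61: `Π•_X ≅ Π^tp_X` and the quotient `Π• ↠ Π•_Y` is group-theoretic):
abc-iut-f-147's `rigidData_cor218_iii_of_isSlimGroup` with `hslimX` SUPPLIED.
[cite: MochizukiEtTh2009, Cor 2.18 (iii) p.61] -/
theorem rigidData_cor218_iii_modelχq (hC : (ThetaSetting.modelχq p i j hj).Compat)
    (hS : (ThetaSetting.modelχq p i j hj).Sec2Hyps) (h15 : ThetaSetting.Prop15iii E hC) (L : C.CuspLabels) :
    Literature.AnabelianGeometry.EtaleTheta.RigidData.Cor218_iii_PiX (C.rigidData μ hC hS h15 L) ∧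
      Literature.AnabelianGeometry.EtaleTheta.RigidData.Cor218_iii_quotient (C.rigidData μ hC hS h15 L) :=
  C.rigidData_cor218_iii_of_isSlimGroup μ hC hS h15 L (isSlimGroup_piTemp_modelχq p i j hj)

/-- **F-0636 / F-0637 (`ThetaEnvData.Cor218_iii_PiX`, `.Cor218_iii_quotient`) at the stage-2 record's
model `ThetaEnvData`** — NO `Prop15iii` binder in this currency (binders `E, C, μ, hC, hS` only):
abc-iut-f-150's `thetaEnvData_cor218_iii_PiX/_quotient` with `hslimX` SUPPLIED.
[cite: MochizukiEtTh2009, Cor 2.18 (iii) p.61] -/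
theorem thetaEnvData_cor218_iii_modelχq (hC : (ThetaSetting.modelχq p i j hj).Compat)
    (hS : (ThetaSetting.modelχq p i j hj).Sec2Hyps) :
    Literature.AnabelianGeometry.EtaleTheta.ThetaEnvData.Cor218_iii_PiX (C.thetaEnvData μ hC hS) ∧
      Literature.AnabelianGeometry.EtaleTheta.ThetaEnvData.Cor218_iii_quotient (C.thetaEnvData μ hC hS) :=
  ⟨C.thetaEnvData_cor218_iii_PiX μ hC hS (isSlimGroup_piTemp_modelχq p i j hj),
    C.thetaEnvData_cor218_iii_quotient μ hC hS (isSlimGroup_piTemp_modelχq p i j hj)⟩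

/-- The same at every level `M ∈ Es` of the stage-2 record's model tower. [cite: MochizukiEtTh2009, Cor 2.18 (iii) p.61] -/
theorem thetaEnvTower_level_cor218_iii_modelχq (hC : (ThetaSetting.modelχq p i j hj).Compat)
    (hS : (ThetaSetting.modelχq p i j hj).Sec2Hyps) (M : Es) :
    Literature.AnabelianGeometry.EtaleTheta.ThetaEnvData.Cor218_iii_PiX ((C.thetaEnvTower τ hC hS).level M) ∧
      Literature.AnabelianGeometry.EtaleTheta.ThetaEnvData.Cor218_iii_quotient
        ((C.thetaEnvTower τ hC hS).level M) :=
  ⟨C.thetaEnvTower_level_cor218_iii_PiX τ hC hS (isSlimGroup_piTemp_modelχq p i j hj) M,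
    C.thetaEnvTower_level_cor218_iii_quotient τ hC hS (isSlimGroup_piTemp_modelχq p i j hj) M⟩

/-! ## §3. Prop 2.14 (iii) — the cusp-label schema at the stage-2 record -/

/-- **F-0634 `RigidData.Prop214_iii_mono` at the stage-2 record's rigidity data HOLDS at every labelling with
EMPTY `Y`-cusp labels** ([EtTh] Prop. 2.14 (iii), p. 49: `Aut(𝕄) → (l·ℤ) ⋊ {±1}` surjective, every automorphism
inducing one of `Π^tp_Y`) — abc-iut-f-149 g0's `prop214_iii_mono_of_cuspY_empty` (at empty labels the row is
EQUIVALENT to Cor. 2.18 (iii)'s quotient clause) with that clause DISCHARGED by §2: no binder beyond the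
construction data. [cite: MochizukiEtTh2009, Prop 2.14 (iii) p.49] -/
theorem rigidData_prop214_iii_mono_modelχq (hC : (ThetaSetting.modelχq p i j hj).Compat)
    (hS : (ThetaSetting.modelχq p i j hj).Sec2Hyps) (h15 : ThetaSetting.Prop15iii E hC) (L : C.CuspLabels)
    (hL : ∀ n, L.cuspY n = ∅) :
    Literature.AnabelianGeometry.EtaleTheta.RigidData.Prop214_iii_mono (C.rigidData μ hC hS h15 L) :=
  Literature.AnabelianGeometry.EtaleTheta.RigidData.prop214_iii_mono_of_cuspY_empty _ (fun n => hL n)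
    (rigidData_cor218_iii_modelχq p i j hj C μ hC hS h15 L).2

/-- **F-0633 `RigidData.Prop214_iii_bi` at the stage-2 record's rigidity data HOLDS at every labelling with
EMPTY `Y`-cusp labels** ([EtTh] Prop. 2.14 (iii), p. 50: `(N·l·ℤ) ⋊ {±1} ⊆ Im_N ⊆ (N†·l·ℤ) ⋊ {±1}`) — g0's
`prop214_iii_bi_of_cuspY_empty` with Cor. 2.18 (iii) DISCHARGED by §2. [cite: MochizukiEtTh2009, Prop 2.14 (iii) p.50] -/
theorem rigidData_prop214_iii_bi_modelχq (hC : (ThetaSetting.modelχq p i j hj).Compat)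
    (hS : (ThetaSetting.modelχq p i j hj).Sec2Hyps) (h15 : ThetaSetting.Prop15iii E hC) (L : C.CuspLabels)
    (hL : ∀ n, L.cuspY n = ∅) :
    Literature.AnabelianGeometry.EtaleTheta.RigidData.Prop214_iii_bi (C.rigidData μ hC hS h15 L) :=
  Literature.AnabelianGeometry.EtaleTheta.RigidData.prop214_iii_bi_of_cuspY_empty _ (fun n => hL n)
    (rigidData_cor218_iii_modelχq p i j hj C μ hC hS h15 L).2

/-- **The `CuspLabels`-explicit form of F-0634 at the stage-2 record** (labelling `⟨∅, cX, hcX⟩` with ANY even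
`X`-family `cX`) — abc-iut-f-149 g0's `rigidData_prop214_iii_mono_of_cuspLabels_empty` with its Cor. 2.18 (iii)
binder DISCHARGED. [cite: MochizukiEtTh2009, Prop 2.14 (iii) p.49] -/
theorem rigidData_prop214_iii_mono_modelχq_of_cuspLabels_empty (hC : (ThetaSetting.modelχq p i j hj).Compat)
    (hS : (ThetaSetting.modelχq p i j hj).Sec2Hyps) (h15 : ThetaSetting.Prop15iii E hC)
    (cX : ZMod l → Set (Subgroup C.Huu)) (hcX : ∀ a, cX (-a) = cX a) :
    Literature.AnabelianGeometry.EtaleTheta.RigidData.Prop214_iii_mono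
      (C.rigidData μ hC hS h15 ⟨fun _ => ∅, cX, hcX⟩) :=
  C.rigidData_prop214_iii_mono_of_cuspLabels_empty μ hC hS h15 cX hcX
    (rigidData_cor218_iii_modelχq p i j hj C μ hC hS h15 _).2

/-- **The `CuspLabels`-explicit form of F-0633 at the stage-2 record.** [cite: MochizukiEtTh2009, Prop 2.14 (iii) p.50] -/
theorem rigidData_prop214_iii_bi_modelχq_of_cuspLabels_empty (hC : (ThetaSetting.modelχq p i j hj).Compat)
    (hS : (ThetaSetting.modelχq p i j hj).Sec2Hyps) (h15 : ThetaSetting.Prop15iii E hC)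
    (cX : ZMod l → Set (Subgroup C.Huu)) (hcX : ∀ a, cX (-a) = cX a) :
    Literature.AnabelianGeometry.EtaleTheta.RigidData.Prop214_iii_bi
      (C.rigidData μ hC hS h15 ⟨fun _ => ∅, cX, hcX⟩) :=
  C.rigidData_prop214_iii_bi_of_cuspLabels_empty μ hC hS h15 cX hcX
    (rigidData_cor218_iii_modelχq p i j hj C μ hC hS h15 _).2

/-- **The cusp-label DICHOTOMY of F-0634 / F-0633 at the stage-2 record** (kernel form of the census label
«schema in the lawless label input `cuspY`»): for every étale-theta datum, `X̲̲`, level, `hC`, `hS`, `h15` over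
`modelχq p i j hj`, BOTH rows HOLD at the empty `Y`-labelling AND there is a labelling (g0's `1 ↦ {⊥}`) at which
BOTH FAIL — the model decides nothing about the labels↔cusps dictionary of Cor. 2.9, which the record does not
carry (`RigidOfSetting` TODO-merge). [cite: MochizukiEtTh2009, Prop 2.14 (iii) p.49] -/
theorem rigidData_prop214_iii_dichotomy_modelχq (hC : (ThetaSetting.modelχq p i j hj).Compat)
    (hS : (ThetaSetting.modelχq p i j hj).Sec2Hyps) (h15 : ThetaSetting.Prop15iii E hC) :
    (Literature.AnabelianGeometry.EtaleTheta.RigidData.Prop214_iii_mono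
        (C.rigidData μ hC hS h15 ⟨fun _ => ∅, fun _ => ∅, fun _ => rfl⟩) ∧
      Literature.AnabelianGeometry.EtaleTheta.RigidData.Prop214_iii_bi
        (C.rigidData μ hC hS h15 ⟨fun _ => ∅, fun _ => ∅, fun _ => rfl⟩)) ∧
    (¬ ∀ L : C.CuspLabels,
        Literature.AnabelianGeometry.EtaleTheta.RigidData.Prop214_iii_mono (C.rigidData μ hC hS h15 L)) ∧
    (¬ ∀ L : C.CuspLabels,
        Literature.AnabelianGeometry.EtaleTheta.RigidData.Prop214_iii_bi (C.rigidData μ hC hS h15 L)) :=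
  ⟨⟨rigidData_prop214_iii_mono_modelχq_of_cuspLabels_empty p i j hj C μ hC hS h15 _ _,
      rigidData_prop214_iii_bi_modelχq_of_cuspLabels_empty p i j hj C μ hC hS h15 _ _⟩,
    C.not_forall_cuspLabels_rigidData_prop214_iii_mono μ hC hS h15,
    C.not_forall_cuspLabels_rigidData_prop214_iii_bi μ hC hS h15⟩

/-! ## §4. Prop 2.14 (ii), Cor 2.18 (ii) — modulo Prop 1.5 (ii) (F-2503) only -/

/-- **F-0632 `RigidData.Prop214_ii` at the stage-2 record's rigidity data, modulo Prop. 1.5 (ii) only**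
([EtTh] Prop. 2.14 (ii), p. 49: "`δ` extends to a cocycle of `Π^tp_Y` … `α_δ` preserves `D_Y`") —
abc-iut-L2-t8's `rigidData_prop214_ii_of_origin` with the guard supplied by `modelχq_isEtThOrigin`.
[cite: MochizukiEtTh2009, Prop 2.14 (ii) p.49] -/
theorem rigidData_prop214_ii_modelχq (hC : (ThetaSetting.modelχq p i j hj).Compat)
    (hS : (ThetaSetting.modelχq p i j hj).Sec2Hyps) (h15 : ThetaSetting.Prop15iii E hC)
    (h15ii : ThetaSetting.Prop15ii E.toKummerData hC) (L : C.CuspLabels) :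
    Literature.AnabelianGeometry.EtaleTheta.RigidData.Prop214_ii (C.rigidData μ hC hS h15 L) :=
  C.rigidData_prop214_ii_of_origin μ hC hS h15 h15ii L (ThetaSetting.modelχq_isEtThOrigin p i j hj)

/-- **F-0621 `RigidData.Cor218_ii` at the stage-2 record's rigidity data, modulo Prop. 1.5 (ii) only**
([EtTh] Cor. 2.18 (ii), p. 60: "precisely the content of Prop. 2.14 (ii)").
[cite: MochizukiEtTh2009, Cor 2.18 (ii) p.60] -/
theorem rigidData_cor218_ii_modelχq (hC : (ThetaSetting.modelχq p i j hj).Compat)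
    (hS : (ThetaSetting.modelχq p i j hj).Sec2Hyps) (h15 : ThetaSetting.Prop15iii E hC)
    (h15ii : ThetaSetting.Prop15ii E.toKummerData hC) (L : C.CuspLabels) :
    Literature.AnabelianGeometry.EtaleTheta.RigidData.Cor218_ii (C.rigidData μ hC hS h15 L) :=
  C.rigidData_cor218_ii_of_origin μ hC hS h15 h15ii L (ThetaSetting.modelχq_isEtThOrigin p i j hj)

/-! ## §5. Cor 2.19 (i) modulo Cor 2.18 (i); Cor 2.18 (iv) reduction; Cor 2.19 (ii) modulo lifting -/

/-- **Cor. 2.19 (i), subquotients (F-0625), at the stage-2 record's rigidity data, modulo Cor. 2.18 (i)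
ALONE** (p. 64): abc-iut-L2-d1's `cor219_i_subquotients_model` with `hslimX` SUPPLIED.
[cite: MochizukiEtTh2009, Cor 2.19 (i) p.64] -/
theorem cor219_i_subquotients_modelχq (hC : (ThetaSetting.modelχq p i j hj).Compat)
    (hS : (ThetaSetting.modelχq p i j hj).Sec2Hyps) (h15 : ThetaSetting.Prop15iii E hC) (L : C.CuspLabels)
    (h218i : (C.rigidData μ hC hS h15 L).Cor218_i) :
    Literature.AnabelianGeometry.EtaleTheta.RigidData.Cor219_i_subquotients (C.rigidData μ hC hS h15 L) :=
  C.cor219_i_subquotients_model μ hC hS h15 L (isSlimGroup_piTemp_modelχq p i j hj) h218i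

/-- **Cor. 2.19 (i), splittings / cyclotomic rigidity (F-0626), at the stage-2 record's rigidity data,
modulo Cor. 2.18 (i) ALONE** (p. 64): abc-iut-L2-d1's `cor219_i_splittings_model` with `hslimX` SUPPLIED and
Prop. 2.14 (i) DISCHARGED by §1. [cite: MochizukiEtTh2009, Cor 2.19 (i) p.64] -/
theorem cor219_i_splittings_modelχq (hC : (ThetaSetting.modelχq p i j hj).Compat)
    (hS : (ThetaSetting.modelχq p i j hj).Sec2Hyps) (h15 : ThetaSetting.Prop15iii E hC) (L : C.CuspLabels)
    (h218i : (C.rigidData μ hC hS h15 L).Cor218_i) :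
    Literature.AnabelianGeometry.EtaleTheta.RigidData.Cor219_i_splittings (C.rigidData μ hC hS h15 L) :=
  C.cor219_i_splittings_model μ hC hS h15 L (isSlimGroup_piTemp_modelχq p i j hj) h218i
    (rigidData_prop214_i_modelχq p i j hj C μ hC hS h15 L)

/-- **Cor. 2.18 (iv), reduction clause (F-0648), for the stage-2 record's model TOWER** (pp. 61–62: every
isomorphism `𝕄_N ≅ 𝕄'_N` reduces to `𝕄_{N'} ≅ 𝕄'_{N'}` for `N' ∣ N`) — NO binder beyond the construction data
`E, C, τ, hC, hS` (no `h15`): abc-iut-L2-d1's `cor218_iv_reduction_model` with `hslimX`, `haugOpen` SUPPLIED.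
[cite: MochizukiEtTh2009, Cor 2.18 (iv) p.61] -/
theorem cor218_iv_reduction_modelχq (hC : (ThetaSetting.modelχq p i j hj).Compat)
    (hS : (ThetaSetting.modelχq p i j hj).Sec2Hyps) :
    Literature.AnabelianGeometry.EtaleTheta.ThetaEnvTower.Cor218_iv_reduction (C.thetaEnvTower τ hC hS) :=
  C.cor218_iv_reduction_model τ hC hS (isSlimGroup_piTemp_modelχq p i j hj) (isOpenMap_aug_modelχq p i j hj)

/-- **Cor. 2.19 (ii) (discrete rigidity, F-0649) for the stage-2 record's model tower, modulo the
level-wise Cor. 2.18 (iv) surjectivity fact ALONE** (p. 64): abc-iut-L2-d1's `cor219_ii_model_of_origin` with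
`hslimX`, `haugOpen`, `IsEtThOrigin`, `hYab` (`dtpYTheta_comm`), `hYcl` SUPPLIED.
[cite: MochizukiEtTh2009, Cor 2.19 (ii) p.64] -/
theorem cor219_ii_modelχq_of_lift (hC : (ThetaSetting.modelχq p i j hj).Compat)
    (hS : (ThetaSetting.modelχq p i j hj).Sec2Hyps) (h15 : ThetaSetting.Prop15iii E hC) (L : C.CuspLabels)
    (hlift : ∀ M : Es, (C.rigidData (τ.mod M) hC hS h15 L).Cor218_iv_surjective) :
    Literature.AnabelianGeometry.EtaleTheta.ThetaEnvTower.Cor219_ii (C.thetaEnvTower τ hC hS) :=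
  C.cor219_ii_model_of_origin τ hC hS h15 L (isSlimGroup_piTemp_modelχq p i j hj)
    (isOpenMap_aug_modelχq p i j hj) hlift (ThetaSetting.modelχq_isEtThOrigin p i j hj)
    ((ThetaSetting.modelχq p i j hj).dtpYTheta_comm (ThetaSetting.modelχq_isEtThOrigin p i j hj))
    (hYcl_modelχq p i j hj)

/-! ## §6. Joint census forms at the stage-2 record, with `hC`, `hS` supplied -/

/-- **The §2 rows of `ThetaRigidity.lean` TOGETHER at the stage-2 record's rigidity data, with `Compat` and
`Sec2Hyps` SUPPLIED** (`compat_modelχq`, `modelχq_sec2Hyps`): for every étale-theta datum `E` over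
`modelχq p i j hj` carrying Prop. 1.5 (iii), every `X̲̲`, level and labelling — Prop. 2.12 (i), (ii),
Prop. 2.14 (i), the fibre clause of Cor. 2.18 (iv), and both clauses of Cor. 2.18 (iii) HOLD.  Binders left =
the construction data `E, C, μ, h15, L` (whether `h15` is inhabited at stage 2 is the R78 cluster's open hand).
[cite: MochizukiEtTh2009, Prop 2.14 (i) p.49] -/
theorem rigidData_sec2_rows_modelχq_holds
    (h15 : ThetaSetting.Prop15iii E (compat_modelχq p i j hj)) (L : C.CuspLabels) :
    Literature.AnabelianGeometry.EtaleTheta.RigidData.Prop212_i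
        (C.rigidData μ (compat_modelχq p i j hj) (ThetaSetting.modelχq_sec2Hyps p i j hj) h15 L) ∧
      Literature.AnabelianGeometry.EtaleTheta.RigidData.Prop212_ii
        (C.rigidData μ (compat_modelχq p i j hj) (ThetaSetting.modelχq_sec2Hyps p i j hj) h15 L) ∧
      Literature.AnabelianGeometry.EtaleTheta.RigidData.Prop214_i
        (C.rigidData μ (compat_modelχq p i j hj) (ThetaSetting.modelχq_sec2Hyps p i j hj) h15 L) ∧
      Literature.AnabelianGeometry.EtaleTheta.RigidData.Cor218_iv_fibre
        (C.rigidData μ (compat_modelχq p i j hj) (ThetaSetting.modelχq_sec2Hyps p i j hj) h15 L) ∧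
      Literature.AnabelianGeometry.EtaleTheta.RigidData.Cor218_iii_PiX
        (C.rigidData μ (compat_modelχq p i j hj) (ThetaSetting.modelχq_sec2Hyps p i j hj) h15 L) ∧
      Literature.AnabelianGeometry.EtaleTheta.RigidData.Cor218_iii_quotient
        (C.rigidData μ (compat_modelχq p i j hj) (ThetaSetting.modelχq_sec2Hyps p i j hj) h15 L) :=
  ⟨rigidData_prop212_i_modelχq p i j hj C μ _ _ h15 L, rigidData_prop212_ii_modelχq p i j hj C μ _ _ h15 L,
    rigidData_prop214_i_modelχq p i j hj C μ _ _ h15 L, rigidData_cor218_iv_fibre_modelχq p i j hj C μ _ _ h15 L,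
    (rigidData_cor218_iii_modelχq p i j hj C μ _ _ h15 L).1,
    (rigidData_cor218_iii_modelχq p i j hj C μ _ _ h15 L).2⟩

/-- **The `h15`-FREE rows at the stage-2 record with `hC`, `hS` supplied**: Cor. 2.18 (iii) (both clauses)
for the model `ThetaEnvData` at level `μ` and Cor. 2.18 (iv) (reduction) for the model tower `τ` — binders
left = `E, C, μ / τ` ONLY. [cite: MochizukiEtTh2009, Cor 2.18 (iii) p.61] -/
theorem thetaEnvData_sec2_rows_modelχq_holds :
    (Literature.AnabelianGeometry.EtaleTheta.ThetaEnvData.Cor218_iii_PiX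
        (C.thetaEnvData μ (compat_modelχq p i j hj) (ThetaSetting.modelχq_sec2Hyps p i j hj)) ∧
      Literature.AnabelianGeometry.EtaleTheta.ThetaEnvData.Cor218_iii_quotient
        (C.thetaEnvData μ (compat_modelχq p i j hj) (ThetaSetting.modelχq_sec2Hyps p i j hj))) ∧
    Literature.AnabelianGeometry.EtaleTheta.ThetaEnvTower.Cor218_iv_reduction
        (C.thetaEnvTower τ (compat_modelχq p i j hj) (ThetaSetting.modelχq_sec2Hyps p i j hj)) :=
  ⟨thetaEnvData_cor218_iii_modelχq p i j hj C μ _ _, cor218_iv_reduction_modelχq p i j hj C τ _ _⟩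

/-! ## §7. The Tate instance `modelTate p = modelχq p 1 2` by name -/

/-- **`Π^tp_X` of the Tate instance is temp-slim.** [cite: MochizukiSemiAnbd2006, Ex 3.10 p.45] -/
theorem isSlimGroup_piTemp_modelTate : IsSlimGroup (ThetaSetting.modelTate p).PiTemp :=
  isSlimGroup_piTemp_modelχq p 1 2 even_two

/-- **`Compat` and `Sec2Hyps` hold at the Tate instance.** [cite: MochizukiEtTh2009, Def 2.5 p.39] -/
theorem compat_and_sec2Hyps_modelTate :
    (ThetaSetting.modelTate p).Compat ∧ (ThetaSetting.modelTate p).Sec2Hyps :=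
  ⟨compat_modelχq p 1 2 even_two, ThetaSetting.modelχq_sec2Hyps p 1 2 even_two⟩

/-- **The §2 rows of `ThetaRigidity.lean` at THE TATE INSTANCE's rigidity data** (F-1920, F-0630, F-0631,
F-0624, F-0622, F-0623), `hC`/`hS` supplied, for every étale-theta datum over `modelTate p` carrying
Prop. 1.5 (iii), every `X̲̲`, level and labelling — §6 at `(i, j) = (1, 2)`.
[cite: MochizukiEtTh2009, Prop 2.14 (i) p.49] -/
theorem rigidData_sec2_rows_modelTate_holds {E : (ThetaSetting.modelTate p).EtaleThetaData} {l : ℕ}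
    (C : E.DoubleUnderline l) {N : ℕ+} (μ : (ThetaSetting.modelTate p).CyclotomeMod l N)
    (h15 : ThetaSetting.Prop15iii E (compat_modelχq p 1 2 even_two)) (L : C.CuspLabels) :
    Literature.AnabelianGeometry.EtaleTheta.RigidData.Prop212_i
        (C.rigidData μ (compat_modelχq p 1 2 even_two) (ThetaSetting.modelχq_sec2Hyps p 1 2 even_two) h15 L) ∧
      Literature.AnabelianGeometry.EtaleTheta.RigidData.Prop212_ii
        (C.rigidData μ (compat_modelχq p 1 2 even_two) (ThetaSetting.modelχq_sec2Hyps p 1 2 even_two) h15 L) ∧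
      Literature.AnabelianGeometry.EtaleTheta.RigidData.Prop214_i
        (C.rigidData μ (compat_modelχq p 1 2 even_two) (ThetaSetting.modelχq_sec2Hyps p 1 2 even_two) h15 L) ∧
      Literature.AnabelianGeometry.EtaleTheta.RigidData.Cor218_iv_fibre
        (C.rigidData μ (compat_modelχq p 1 2 even_two) (ThetaSetting.modelχq_sec2Hyps p 1 2 even_two) h15 L) ∧
      Literature.AnabelianGeometry.EtaleTheta.RigidData.Cor218_iii_PiX
        (C.rigidData μ (compat_modelχq p 1 2 even_two) (ThetaSetting.modelχq_sec2Hyps p 1 2 even_two) h15 L) ∧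
      Literature.AnabelianGeometry.EtaleTheta.RigidData.Cor218_iii_quotient
        (C.rigidData μ (compat_modelχq p 1 2 even_two) (ThetaSetting.modelχq_sec2Hyps p 1 2 even_two) h15 L) :=
  rigidData_sec2_rows_modelχq_holds p 1 2 even_two C μ h15 L

/-- **F-0634 / F-0633 at THE TATE INSTANCE: the cusp-label dichotomy** (hold at the empty `Y`-labelling, fail
at `1 ↦ {⊥}`), `hC`/`hS` supplied. [cite: MochizukiEtTh2009, Prop 2.14 (iii) p.49] -/
theorem rigidData_prop214_iii_dichotomy_modelTate {E : (ThetaSetting.modelTate p).EtaleThetaData} {l : ℕ}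
    (C : E.DoubleUnderline l) {N : ℕ+} (μ : (ThetaSetting.modelTate p).CyclotomeMod l N)
    (h15 : ThetaSetting.Prop15iii E (compat_modelχq p 1 2 even_two)) :
    (Literature.AnabelianGeometry.EtaleTheta.RigidData.Prop214_iii_mono
        (C.rigidData μ (compat_modelχq p 1 2 even_two) (ThetaSetting.modelχq_sec2Hyps p 1 2 even_two) h15
          ⟨fun _ => ∅, fun _ => ∅, fun _ => rfl⟩) ∧
      Literature.AnabelianGeometry.EtaleTheta.RigidData.Prop214_iii_bi
        (C.rigidData μ (compat_modelχq p 1 2 even_two) (ThetaSetting.modelχq_sec2Hyps p 1 2 even_two) h15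
          ⟨fun _ => ∅, fun _ => ∅, fun _ => rfl⟩)) ∧
    (¬ ∀ L : C.CuspLabels, Literature.AnabelianGeometry.EtaleTheta.RigidData.Prop214_iii_mono
        (C.rigidData μ (compat_modelχq p 1 2 even_two) (ThetaSetting.modelχq_sec2Hyps p 1 2 even_two) h15 L)) ∧
    (¬ ∀ L : C.CuspLabels, Literature.AnabelianGeometry.EtaleTheta.RigidData.Prop214_iii_bi
        (C.rigidData μ (compat_modelχq p 1 2 even_two) (ThetaSetting.modelχq_sec2Hyps p 1 2 even_two) h15 L)) :=
  rigidData_prop214_iii_dichotomy_modelχq p 1 2 even_two C μ _ _ h15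

/-- **The `h15`-free rows at THE TATE INSTANCE** (Cor. 2.18 (iii) for the model `ThetaEnvData`, Cor. 2.18 (iv)
reduction for the model tower), `hC`/`hS` supplied — binders `E, C, μ / τ` only.
[cite: MochizukiEtTh2009, Cor 2.18 (iii) p.61] -/
theorem thetaEnvData_sec2_rows_modelTate_holds {E : (ThetaSetting.modelTate p).EtaleThetaData} {l : ℕ}
    (C : E.DoubleUnderline l) {N : ℕ+} (μ : (ThetaSetting.modelTate p).CyclotomeMod l N) {Es : Set ℕ+}
    (τ : (ThetaSetting.modelTate p).CyclotomeTower l Es) :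
    (Literature.AnabelianGeometry.EtaleTheta.ThetaEnvData.Cor218_iii_PiX
        (C.thetaEnvData μ (compat_modelχq p 1 2 even_two) (ThetaSetting.modelχq_sec2Hyps p 1 2 even_two)) ∧
      Literature.AnabelianGeometry.EtaleTheta.ThetaEnvData.Cor218_iii_quotient
        (C.thetaEnvData μ (compat_modelχq p 1 2 even_two) (ThetaSetting.modelχq_sec2Hyps p 1 2 even_two))) ∧
    Literature.AnabelianGeometry.EtaleTheta.ThetaEnvTower.Cor218_iv_reduction
        (C.thetaEnvTower τ (compat_modelχq p 1 2 even_two) (ThetaSetting.modelχq_sec2Hyps p 1 2 even_two)) :=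
  thetaEnvData_sec2_rows_modelχq_holds p 1 2 even_two C μ τ

end Literature.AnabelianGeometry.EtaleTheta.SettingModel

end
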